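import Summits.Ventures.PercRepro.LemmaBSlackTwo

/-!
# The transversal bound: `crossCount ≤ topBotCount + (defects at one cell)`

proofs/P4-gen9.md §11. For three distinct cells `i, j, k` the family
`ℬ = crossFam i j ∪ crossFam i k ∪ crossFam k j` contains exactly one member of every bad pair, so
`|ℬ| = crossCount` (`card_transversal`). Its differences are good (`botSet`) except for the single
conflicting type pair `(i, k)` / `(k, j)`: `A \ B` with `A ∈ crossFam i k`, `B ∈ crossFam k j` has
cell `⊥` and complement cell `≥ cross4 k` (`halfBot`), and `B \ A` has complement `⊤` and cell
`≤ cross4 k` (`halfTop`) — `diffs_transversal_subset`. Marica–Schönheim then gives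

  (T)  `crossCount ≤ topBotCount + |halfBot k ∩ D(ℬ)| + |halfTop k ∩ D(ℬ)|`

(`crossCount_le_topBotCount_add_defects`). In particular **Lemma B holds whenever the conflicting
differences are good** (`crossCount_le_topBotCount_of_defects_good`).

The two CONFLICT-FREE three-type families `famA = crossFam i j ∪ crossFam k j` and
`famB = crossFam i k ∪ crossFam j k` have all their differences good, so Marica–Schönheim and
`|D(famA) ∪ D(famB)| ≤ topBotCount` give the overlap bound

  (T′)  `crossCount + p_jk ≤ topBotCount + |D(famA) ∩ D(famB)|`

(`crossCount_add_le_topBotCount_add_inter`); **Lemma B holds whenever the two difference families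
overlap in at most `p_jk` sets** (`crossCount_le_topBotCount_of_inter_le`).
-/

namespace PercRepro

open Finset
open scoped FinsetFamily

section Transversal

variable {S : Type} [Fintype S] [DecidableEq S]

open Classical in
/-- The «half-good» sets at cell `k`, bottom kind: cell `⊥`, complement cell above `cross4 k` but
not `⊤`. -/
noncomputable def halfBot (c : Config S → Setoid (Fin 4)) (k : Fin 3) : Finset (Config S) :=
  Finset.univ.filter fun W => c W = ⊥ ∧ cross4 k ≤ c Wᶜ ∧ c Wᶜ ≠ ⊤

open Classical in
/-- The «half-good» sets at cell `k`, top kind: complement cell `⊤`, cell below `cross4 k` but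
not `⊥`. -/
noncomputable def halfTop (c : Config S → Setoid (Fin 4)) (k : Fin 3) : Finset (Config S) :=
  Finset.univ.filter fun W => c W ≠ ⊥ ∧ c W ≤ cross4 k ∧ c Wᶜ = ⊤

/-- The transversal `ℬ = crossFam i j ∪ crossFam i k ∪ crossFam k j`. -/
noncomputable def transversal (c : Config S → Setoid (Fin 4)) (i j k : Fin 3) :
    Finset (Config S) :=
  crossFam cross4 c i j ∪ crossFam cross4 c i k ∪ crossFam cross4 c k j

/-- The transversal has one member of every bad pair: `|ℬ| = crossCount`. -/
theorem card_transversal (c : Config S → Setoid (Fin 4)) {i j k : Fin 3} (hij : i ≠ j)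
    (hik : i ≠ k) (hjk : j ≠ k) : (transversal c i j k).card = crossCount cross4 c := by
  have hd1 : Disjoint (crossFam cross4 c i j) (crossFam cross4 c i k) :=
    disjoint_crossFam_of_ne cross4 c cross4_injective i hjk
  have hd2 : Disjoint (crossFam cross4 c i j ∪ crossFam cross4 c i k) (crossFam cross4 c k j) := by
    rw [Finset.disjoint_left]
    intro ω hω hω'
    obtain ⟨-, e1, -⟩ := (mem_crossFam cross4 c).1 hω'
    rcases Finset.mem_union.1 hω with h | h
    · obtain ⟨-, e2, -⟩ := (mem_crossFam cross4 c).1 h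
      exact hik (cross4_injective (e2.symm.trans e1))
    · obtain ⟨-, e2, -⟩ := (mem_crossFam cross4 c).1 h
      exact hik (cross4_injective (e2.symm.trans e1))
  rw [transversal, Finset.card_union_of_disjoint hd2, Finset.card_union_of_disjoint hd1,
    crossCount_eq_three c cross4 cross4_injective]
  have h01 := card_crossFam_comm cross4 c 0 1
  have h02 := card_crossFam_comm cross4 c 0 2
  have h12 := card_crossFam_comm cross4 c 1 2
  have e2 : (⟨2, by decide⟩ : Fin 3) = 2 := rfl
  fin_cases i <;> fin_cases j <;> fin_cases k <;> simp at hij hik hjk <;>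
    simp only [Fin.zero_eta, Fin.mk_one, e2] at * <;> omega

omit [Fintype S] [DecidableEq S] in
/-- The lattice facts about a difference of two configurations. -/
theorem cell_sdiff_le {c : Config S → Setoid (Fin 4)} (hc : Monotone c) (A B : Config S) :
    c (A \ B) ≤ c A ⊓ c Bᶜ ∧ c Aᶜ ⊔ c B ≤ c (A \ B)ᶜ := by
  constructor
  · exact le_inf (hc sdiff_le) (hc (by rw [sdiff_eq]; exact inf_le_right))
  · exact sup_le (hc (compl_le_compl sdiff_le))
      (hc (le_compl_iff_disjoint_right.2 disjoint_sdiff_self_right))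

/-- A difference of two bad configurations whose types do not conflict is good. -/
theorem sdiff_mem_botSet_of_ne {c : Config S → Setoid (Fin 4)} (hc : Monotone c)
    {A B : Config S} {a b a' b' : Fin 3} (hA : A ∈ crossFam cross4 c a b)
    (hB : B ∈ crossFam cross4 c a' b') (h1 : a ≠ b') (h2 : b ≠ a') : A \ B ∈ botSet c := by
  obtain ⟨-, hA1, hA2⟩ := (mem_crossFam cross4 c).1 hA
  obtain ⟨-, hB1, hB2⟩ := (mem_crossFam cross4 c).1 hB
  obtain ⟨hW1, hW2⟩ := cell_sdiff_le hc A B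
  rw [hA1, hB2, cross4_isCrossingFamily.inf_eq_bot h1] at hW1
  rw [hA2, hB1, cross4_isCrossingFamily.sup_eq_top h2] at hW2
  exact mem_botSet.2 ⟨le_bot_iff.1 hW1, top_le_iff.1 hW2⟩

/-- **The differences of the transversal** lie in the good set or in one of the two defect sets
at `k`. -/
theorem diffs_transversal_subset {c : Config S → Setoid (Fin 4)} (hc : Monotone c) {i j k : Fin 3}
    (hij : i ≠ j) (hik : i ≠ k) (hjk : j ≠ k) :
    transversal c i j k \\ transversal c i j k ⊆
      botSet c ∪ (halfBot c k ∩ (transversal c i j k \\ transversal c i j k)) ∪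
        (halfTop c k ∩ (transversal c i j k \\ transversal c i j k)) := by
  intro W hW
  obtain ⟨A, hA, B, hB, rfl⟩ := Finset.mem_diffs.1 hW
  have hG : ∀ {a b a' b' : Fin 3}, A ∈ crossFam cross4 c a b → B ∈ crossFam cross4 c a' b' →
      a ≠ b' → b ≠ a' → A \ B ∈ botSet c ∪
        (halfBot c k ∩ (transversal c i j k \\ transversal c i j k)) ∪
        (halfTop c k ∩ (transversal c i j k \\ transversal c i j k)) :=
    fun hA hB h1 h2 => Finset.mem_union_left _ (Finset.mem_union_left _
      (sdiff_mem_botSet_of_ne hc hA hB h1 h2))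
  unfold transversal at hA hB
  rcases Finset.mem_union.1 hA with hA | hA
  · rcases Finset.mem_union.1 hA with hA | hA
    · -- `A` of type `(i, j)`
      rcases Finset.mem_union.1 hB with hB | hB
      · rcases Finset.mem_union.1 hB with hB | hB
        · exact hG hA hB hij (Ne.symm hij)
        · exact hG hA hB hik (Ne.symm hij)
      · exact hG hA hB hij hjk
    · -- `A` of type `(i, k)`
      rcases Finset.mem_union.1 hB with hB | hB
      · rcases Finset.mem_union.1 hB with hB | hB
        · exact hG hA hB hij (Ne.symm hik)
        · exact hG hA hB hik (Ne.symm hik)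
      · -- the conflict `(i, k)` / `(k, j)`: cell `⊥`, complement above `cross4 k`
        obtain ⟨-, hA1, hA2⟩ := (mem_crossFam cross4 c).1 hA
        obtain ⟨-, hB1, hB2⟩ := (mem_crossFam cross4 c).1 hB
        obtain ⟨hW1, hW2⟩ := cell_sdiff_le hc A B
        rw [hA1, hB2, cross4_isCrossingFamily.inf_eq_bot hij] at hW1
        rw [hA2, hB1, sup_idem] at hW2
        by_cases htop : c (A \ B)ᶜ = ⊤
        · exact Finset.mem_union_left _ (Finset.mem_union_left _
            (mem_botSet.2 ⟨le_bot_iff.1 hW1, htop⟩))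
        · refine Finset.mem_union_left _ (Finset.mem_union_right _ (Finset.mem_inter.2 ⟨?_, hW⟩))
          simp only [halfBot, Finset.mem_filter, Finset.mem_univ, true_and]
          exact ⟨le_bot_iff.1 hW1, hW2, htop⟩
  · -- `A` of type `(k, j)`
    rcases Finset.mem_union.1 hB with hB | hB
    · rcases Finset.mem_union.1 hB with hB | hB
      · exact hG hA hB (Ne.symm hjk) (Ne.symm hij)
      · -- the conflict `(k, j)` / `(i, k)`: complement `⊤`, cell below `cross4 k`
        obtain ⟨-, hA1, hA2⟩ := (mem_crossFam cross4 c).1 hA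
        obtain ⟨-, hB1, hB2⟩ := (mem_crossFam cross4 c).1 hB
        obtain ⟨hW1, hW2⟩ := cell_sdiff_le hc A B
        rw [hA1, hB2, inf_idem] at hW1
        rw [hA2, hB1, cross4_isCrossingFamily.sup_eq_top (Ne.symm hij)] at hW2
        by_cases hbot : c (A \ B) = ⊥
        · exact Finset.mem_union_left _ (Finset.mem_union_left _
            (mem_botSet.2 ⟨hbot, top_le_iff.1 hW2⟩))
        · refine Finset.mem_union_right _ (Finset.mem_inter.2 ⟨?_, hW⟩)
          simp only [halfTop, Finset.mem_filter, Finset.mem_univ, true_and]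
          exact ⟨hbot, hW1, top_le_iff.1 hW2⟩
    · exact hG hA hB (Ne.symm hjk) hjk

/-- **The transversal bound (T)**: `crossCount ≤ topBotCount + |halfBot k ∩ D(ℬ)| +
|halfTop k ∩ D(ℬ)|` for every monotone map and every labelling `i, j, k` of the cells. -/
theorem crossCount_le_topBotCount_add_defects (c : Config S → Setoid (Fin 4)) (hc : Monotone c)
    {i j k : Fin 3} (hij : i ≠ j) (hik : i ≠ k) (hjk : j ≠ k) :
    crossCount cross4 c ≤ topBotCount c +
      (halfBot c k ∩ (transversal c i j k \\ transversal c i j k)).card +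
      (halfTop c k ∩ (transversal c i j k \\ transversal c i j k)).card := by
  calc crossCount cross4 c = (transversal c i j k).card := (card_transversal c hij hik hjk).symm
    _ ≤ (transversal c i j k \\ transversal c i j k).card := Finset.card_le_card_diffs _
    _ ≤ (botSet c ∪ (halfBot c k ∩ (transversal c i j k \\ transversal c i j k)) ∪
        (halfTop c k ∩ (transversal c i j k \\ transversal c i j k))).card :=
      Finset.card_le_card (diffs_transversal_subset hc hij hik hjk)
    _ ≤ (botSet c).card + (halfBot c k ∩ (transversal c i j k \\ transversal c i j k)).card +
        (halfTop c k ∩ (transversal c i j k \\ transversal c i j k)).card :=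
      (Finset.card_union_le _ _).trans (Nat.add_le_add_right (Finset.card_union_le _ _) _)
    _ = _ := by rw [card_botSet]

/-- **Lemma B whenever the conflicting differences are good**: if for some labelling the
differences `A \ B` and `B \ A` (`A ∈ crossFam i k`, `B ∈ crossFam k j`) are all good, then
`crossCount ≤ topBotCount`. -/
theorem crossCount_le_topBotCount_of_defects_good (c : Config S → Setoid (Fin 4)) (hc : Monotone c)
    {i j k : Fin 3} (hij : i ≠ j) (hik : i ≠ k) (hjk : j ≠ k)
    (hgood : ∀ A ∈ crossFam cross4 c i k, ∀ B ∈ crossFam cross4 c k j,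
      A \ B ∈ botSet c ∧ B \ A ∈ botSet c) :
    crossCount cross4 c ≤ topBotCount c := by
  have hsub : transversal c i j k \\ transversal c i j k ⊆ botSet c := by
    intro W hW
    obtain ⟨A, hA, B, hB, rfl⟩ := Finset.mem_diffs.1 hW
    unfold transversal at hA hB
    rcases Finset.mem_union.1 hA with hA | hA
    · rcases Finset.mem_union.1 hA with hA | hA
      · rcases Finset.mem_union.1 hB with hB | hB
        · rcases Finset.mem_union.1 hB with hB | hB
          · exact sdiff_mem_botSet_of_ne hc hA hB hij (Ne.symm hij)
          · exact sdiff_mem_botSet_of_ne hc hA hB hik (Ne.symm hij)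
        · exact sdiff_mem_botSet_of_ne hc hA hB hij hjk
      · rcases Finset.mem_union.1 hB with hB | hB
        · rcases Finset.mem_union.1 hB with hB | hB
          · exact sdiff_mem_botSet_of_ne hc hA hB hij (Ne.symm hik)
          · exact sdiff_mem_botSet_of_ne hc hA hB hik (Ne.symm hik)
        · exact (hgood A hA B hB).1
    · rcases Finset.mem_union.1 hB with hB | hB
      · rcases Finset.mem_union.1 hB with hB | hB
        · exact sdiff_mem_botSet_of_ne hc hA hB (Ne.symm hjk) (Ne.symm hij)
        · exact (hgood B hB A hA).2
      · exact sdiff_mem_botSet_of_ne hc hA hB (Ne.symm hjk) hjk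
  calc crossCount cross4 c = (transversal c i j k).card := (card_transversal c hij hik hjk).symm
    _ ≤ (transversal c i j k \\ transversal c i j k).card := Finset.card_le_card_diffs _
    _ ≤ (botSet c).card := Finset.card_le_card hsub
    _ = topBotCount c := card_botSet c

/-! ### The two conflict-free three-type families and the overlap bound (T′) -/

/-- The conflict-free family `famA = crossFam i j ∪ crossFam k j` (complement cell `j`). -/
noncomputable def famA (c : Config S → Setoid (Fin 4)) (i j k : Fin 3) : Finset (Config S) :=
  crossFam cross4 c i j ∪ crossFam cross4 c k j

/-- The conflict-free family `famB = crossFam i k ∪ crossFam j k` (complement cell `k`). -/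
noncomputable def famB (c : Config S → Setoid (Fin 4)) (i j k : Fin 3) : Finset (Config S) :=
  crossFam cross4 c i k ∪ crossFam cross4 c j k

/-- All differences of `famA` are good. -/
theorem diffs_famA_subset {c : Config S → Setoid (Fin 4)} (hc : Monotone c) {i j k : Fin 3}
    (hij : i ≠ j) (hjk : j ≠ k) : famA c i j k \\ famA c i j k ⊆ botSet c := by
  intro W hW
  obtain ⟨A, hA, B, hB, rfl⟩ := Finset.mem_diffs.1 hW
  unfold famA at hA hB
  rcases Finset.mem_union.1 hA with hA | hA <;> rcases Finset.mem_union.1 hB with hB | hB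
  · exact sdiff_mem_botSet_of_ne hc hA hB hij (Ne.symm hij)
  · exact sdiff_mem_botSet_of_ne hc hA hB hij hjk
  · exact sdiff_mem_botSet_of_ne hc hA hB (Ne.symm hjk) (Ne.symm hij)
  · exact sdiff_mem_botSet_of_ne hc hA hB (Ne.symm hjk) hjk

/-- All differences of `famB` are good. -/
theorem diffs_famB_subset {c : Config S → Setoid (Fin 4)} (hc : Monotone c) {i j k : Fin 3}
    (hik : i ≠ k) (hjk : j ≠ k) : famB c i j k \\ famB c i j k ⊆ botSet c := by
  intro W hW
  obtain ⟨A, hA, B, hB, rfl⟩ := Finset.mem_diffs.1 hW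
  unfold famB at hA hB
  rcases Finset.mem_union.1 hA with hA | hA <;> rcases Finset.mem_union.1 hB with hB | hB
  · exact sdiff_mem_botSet_of_ne hc hA hB hik (Ne.symm hik)
  · exact sdiff_mem_botSet_of_ne hc hA hB hik (Ne.symm hjk)
  · exact sdiff_mem_botSet_of_ne hc hA hB hjk (Ne.symm hik)
  · exact sdiff_mem_botSet_of_ne hc hA hB hjk (Ne.symm hjk)

/-- `|famA| = p_ij + p_kj`. -/
theorem card_famA (c : Config S → Setoid (Fin 4)) {i j k : Fin 3} (hik : i ≠ k) :
    (famA c i j k).card = (crossFam cross4 c i j).card + (crossFam cross4 c k j).card := by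
  unfold famA
  refine Finset.card_union_of_disjoint ?_
  rw [Finset.disjoint_left]
  intro ω h1 h2
  obtain ⟨-, e1, -⟩ := (mem_crossFam cross4 c).1 h1
  obtain ⟨-, e2, -⟩ := (mem_crossFam cross4 c).1 h2
  exact hik (cross4_injective (e1.symm.trans e2))

/-- `|famB| = p_ik + p_jk`. -/
theorem card_famB (c : Config S → Setoid (Fin 4)) {i j k : Fin 3} (hij : i ≠ j) :
    (famB c i j k).card = (crossFam cross4 c i k).card + (crossFam cross4 c j k).card := by
  unfold famB
  refine Finset.card_union_of_disjoint ?_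
  rw [Finset.disjoint_left]
  intro ω h1 h2
  obtain ⟨-, e1, -⟩ := (mem_crossFam cross4 c).1 h1
  obtain ⟨-, e2, -⟩ := (mem_crossFam cross4 c).1 h2
  exact hij (cross4_injective (e1.symm.trans e2))

/-- **The overlap bound (T′)**: `crossCount + p_jk ≤ topBotCount + |D(famA) ∩ D(famB)|`. -/
theorem crossCount_add_le_topBotCount_add_inter (c : Config S → Setoid (Fin 4)) (hc : Monotone c)
    {i j k : Fin 3} (hij : i ≠ j) (hik : i ≠ k) (hjk : j ≠ k) :
    crossCount cross4 c + (crossFam cross4 c j k).card ≤ topBotCount c +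
      ((famA c i j k \\ famA c i j k) ∩ (famB c i j k \\ famB c i j k)).card := by
  have hA := Finset.card_le_card_diffs (famA c i j k)
  have hB := Finset.card_le_card_diffs (famB c i j k)
  have hU : ((famA c i j k \\ famA c i j k) ∪ (famB c i j k \\ famB c i j k)).card ≤
      topBotCount c := by
    rw [← card_botSet]
    exact Finset.card_le_card (Finset.union_subset (diffs_famA_subset hc hij hjk)
      (diffs_famB_subset hc hik hjk))
  have hUI := Finset.card_union_add_card_inter (famA c i j k \\ famA c i j k)
    (famB c i j k \\ famB c i j k)
  have hcross : crossCount cross4 c = (crossFam cross4 c i j).card + (crossFam cross4 c i k).card +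
      (crossFam cross4 c k j).card := by
    rw [← card_transversal c hij hik hjk, transversal, Finset.card_union_of_disjoint,
      Finset.card_union_of_disjoint]
    · exact disjoint_crossFam_of_ne cross4 c cross4_injective i hjk
    · rw [Finset.disjoint_left]
      intro ω hω hω'
      obtain ⟨-, e1, -⟩ := (mem_crossFam cross4 c).1 hω'
      rcases Finset.mem_union.1 hω with h | h
      · obtain ⟨-, e2, -⟩ := (mem_crossFam cross4 c).1 h
        exact hik (cross4_injective (e2.symm.trans e1))
      · obtain ⟨-, e2, -⟩ := (mem_crossFam cross4 c).1 h
        exact hik (cross4_injective (e2.symm.trans e1))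
  rw [card_famA c hik] at hA
  rw [card_famB c hij] at hB
  omega

/-- **Lemma B whenever the two difference families overlap little**: if
`|D(famA) ∩ D(famB)| ≤ p_jk` for some labelling, then `crossCount ≤ topBotCount`. -/
theorem crossCount_le_topBotCount_of_inter_le (c : Config S → Setoid (Fin 4)) (hc : Monotone c)
    {i j k : Fin 3} (hij : i ≠ j) (hik : i ≠ k) (hjk : j ≠ k)
    (h : ((famA c i j k \\ famA c i j k) ∩ (famB c i j k \\ famB c i j k)).card ≤
      (crossFam cross4 c j k).card) : crossCount cross4 c ≤ topBotCount c := by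
  have := crossCount_add_le_topBotCount_add_inter c hc hij hik hjk
  omega

end Transversal

end PercRepro
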